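import Literature.AlgebraicGeometry.ShimuraVarieties.UnitaryAuxiliaryHeckeQuotientDescent
import Literature.AlgebraicGeometry.ShimuraVarieties.UnitaryAuxiliaryHeckeQuotientDescentGeneral
import Literature.AlgebraicGeometry.ShimuraVarieties.UnitaryAuxiliaryTorusClassNumberProofs
import Literature.AlgebraicGeometry.ShimuraVarieties.UnitaryAuxiliaryTorusUnitLevel
import Literature.AlgebraicGeometry.ShimuraVarieties.UnitaryAuxiliaryReflexBookkeeping
import Literature.AlgebraicGeometry.ShimuraVarieties.UnitaryAuxiliaryReflexInduced
import Literature.AlgebraicGeometry.ShimuraVarieties.UnitaryShimuraCanonicalModelTowerReflex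
import Summits.HodgeConjecture.CorCM.HypDel.HypDelGaloisCaseOfF1
import HarnessLib

/-!
# `hDel♭` from F1 alone in the SMALL-REFLEX CASE — every CM field containing an imaginary quadratic field
# (cell `hodgecm-mathlib`, fan A/B junction, binder `hDel` → `HypDel`; §16 of the crux workfile
# `Cruxes/HDel/Lines/B1HeckeQuotientDescent.lean`, v10b sha16 d4745cf876192b63)

Summits side (flat `Theorems/` of the sub-problem `HodgeConjecture`, supporting item 24835 = binder `hDel`; namespace
`Summit.HodgeConjecture.CorCM.HypDel` as its sibling `CorCM/HypDel/HypDelGaloisCaseOfF1`, p596634).  The Galois hypothesis of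
`galoisCase_of_F1` enters chain B at exactly ONE point: `Aux.HasSmallReflex L Φ τ` (the reflex-trace field `E*(Φ)`
lies in `τ(L)`, so `E♯(Φ) = τ(L)`).  This file proves the descent `hDel♭ ⇐ F1` under that hypothesis alone
(`smallReflexCase_of_F1`), and feeds it with the induced CM types of `UnitaryAuxiliaryReflexInduced`: every CM field
`L` containing an imaginary quadratic field `K₀` (`j : K₀ →+* L`; Galois over `ℚ` or not) has a `τ`-adapted CM type with
small reflex, whence `quadraticSubfieldCase_of_F1`; the Galois case `galoisCase_of_F1` (p596634) is the special case
`smallReflexCase_of_F1 hF1 … (Aux.exists_isAdapted_and_hasSmallReflex_of_isGalois L τ)` (not restated here).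

* `smallReflexCase_of_F1 (hF1 : Aux.canonicalModel_exists_printed)` — for every CM field `L`, frame `τ`, Hermitian `H`
  of signature `(2,1)` at `τ` and definite elsewhere, anisotropic, neat level `K₀`, complex record system `Sc`, IF some
  `τ`-adapted CM type has small reflex THEN `Sc.Mc` has an `L`-form along `τ` with Shimura reciprocity (62)
  (`IsCanonicalDescentAt`).  Proof: chain B (`HeckeQuotient.galoisLegDescentOver_of_F1_only hF1`, the `E♯(Φ)`-form with
  `IsCanonicalDescentOver`), the tower lemma `forall_exists_form_of_reflexField` (every `E ⊇ τ(L)·E*(Φ)`), and small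
  reflex lets `E := L`, `ιE := τ`, where the `E`-formula IS `IsCanonicalDescentAt` definitionally;
* `quadraticSubfieldCase_of_F1 (hF1) (h2 : finrank ℚ K₀ = 2)` — the same conclusion for every `L` with `j : K₀ →+* L`
  (`Aux.exists_isAdapted_and_hasSmallReflex_of_quadraticSubfield`);

Both are CONDITIONAL on the named fact F1 = `Aux.canonicalModel_exists_printed` only ([Deligne1979ShimuraVarieties]
2.3.1 on the auxiliary Hodge-type datum; D-0014).  HC_CM is proved only modulo the 7 printed citations until rung 0
closes; this file discharges no binder (`HypDel` still needs the residual «no adapted CM type with small reflex», TIER G).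

## References
* [Deligne1979ShimuraVarieties] 2.2.5, 2.3.1; [Deligne1971TravauxShimura] Prop. 5.11, Cor. 5.7;
  [MilneCM2006] Ch. I §1 Prop. 1.18 (c); [Shimura1998] §8.3 Prop. 28, §8.4 Example (1); [Liu2021] App. C Lem. C.14, Rem. C.15.
-/

set_option autoImplicit false

noncomputable section

open Function MulAction NumberField IsDedekindDomain CategoryTheory CategoryTheory.Limits Matrix
  AlgebraicGeometry
open scoped Matrix ComplexOrder
open Literature.AlgebraicGeometry.Motives
open Literature.NumberTheory.Automorphic Literature.NumberTheory.Automorphic.UnitaryGroup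
open Literature.NumberTheory.Automorphic.Liu2021.AppendixC (C5.OpenCompactSubgroup C5.SmallLevel)
open Literature.Geometry.ComplexHyperbolic Literature.Geometry.ComplexHyperbolic.BallModel
open Literature.NumberTheory.Automorphic.ShimuraDissection
open Literature.AlgebraicGeometry.ShimuraVarieties
open Literature.AlgebraicGeometry.ShimuraVarieties.UnitaryCanonicalModel
open Literature.NumberTheory.ComplexMultiplication (traceField traceField_le_fieldRange)

namespace Summit.HodgeConjecture.CorCM.HypDel

/-- **`hDel♭ ⇐ F1` in the SMALL-REFLEX CASE** (supersedes the Galois case `galoisCase_of_F1`, p596634: same proof with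
the instance `IsGalois ℚ L` replaced by the hypothesis it was used for): if some `τ`-adapted CM type `Φ` has
`E*(Φ) ⊆ τ(L)`, then every complex record system `Sc` of `Sh(U(H), 𝔹²)` below a neat level `K₀` has an `L`-form along
`τ` with Shimura reciprocity (62) (`IsCanonicalDescentAt`).  Proof: chain B (`HeckeQuotient.galoisLegDescentOver_of_F1_only
hF1`) gives an `E♯(Φ)`-form with `IsCanonicalDescentOver`; the tower lemma `forall_exists_form_of_reflexField` spreads it
to every `E ⊇ τ(L)·E*(Φ)`; small reflex lets `E := L`, `ιE := τ`, where the `E`-formula IS `IsCanonicalDescentAt`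
definitionally.  Statement and proof = §16 `smallReflexCase_of_F1` of the crux workfile (v10b d4745cf876192b63).
[cite: Deligne1979ShimuraVarieties, 2.2.5 and 2.3.1] [cite: Deligne1971TravauxShimura, Prop. 5.11, Cor. 5.7]
[cite: Liu2021, App. C Lem. C.14, Rem. C.15] -/
theorem smallReflexCase_of_F1 (hF1 : Aux.canonicalModel_exists_printed) :
    ∀ (L : Type) [Field L] [NumberField L] [IsCMField L] (H : Matrix (Fin 3) (Fin 3) L) (τ : L →+* ℂ)
      (T : GL (Fin 3) ℂ) (hT : formCongr (starRingEnd ℂ) T (H.map τ) = BallModel.J),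
      (∀ τ' : L →+* ℂ, InfinitePlace.mk τ' ≠ InfinitePlace.mk τ → (H.map τ').PosDef) →
      (∀ v : Fin 3 → L, hermForm (cmConjRingHom L) H v v = 0 → v = 0) →
      ∀ K₀ : C5.OpenCompactSubgroup ↥(finAdelic (↥(maximalRealSubfield L)) L (IsCMField.complexConj L) 3 H),
        (∀ g : finAdelic (↥(maximalRealSubfield L)) L (IsCMField.complexConj L) 3 H,
          ∀ γ ∈ arithmeticLevel (↥(maximalRealSubfield L)) L (IsCMField.complexConj L) 3 H
            (K₀.1.map (MulAut.conj g).toMonoidHom), IsOfFinOrder γ → γ = 1) →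
        ∀ Sc : ComplexRecordSystem L H τ T hT K₀,
          (∃ Φ : CMType L, Aux.IsAdapted L Φ τ ∧ Aux.HasSmallReflex L Φ τ) →
          ∃ (M : C5.SmallLevel K₀ ⥤ SchemeOver L) (e : (M ⋙ baseChangeHom τ) ≅ Sc.Mc),
            IsCanonicalDescentAt Sc M e := by
  intro L _ _ _ H τ T hT hpos hanis K₀ htf Sc hsm
  obtain ⟨Φ, hΦ, hsmall⟩ := hsm
  obtain ⟨M₁, e₁, h₁⟩ := HeckeQuotient.galoisLegDescentOver_of_F1_only hF1 L H τ T hT hpos hanis K₀ htf Sc Φ hΦ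
  have hE : (traceField Φ : Set ℂ) ⊆ Set.range τ := by
    intro x hx
    obtain ⟨y, hy⟩ := AlgHom.mem_fieldRange.1 (hsmall hx)
    exact ⟨y, by simpa using hy⟩
  obtain ⟨M, e, hrec⟩ := forall_exists_form_of_reflexField Φ Sc M₁ e₁ h₁ L τ subset_rfl hE
  exact ⟨M, e, hrec⟩

/-- **`hDel♭ ⇐ F1` for every CM field containing an imaginary quadratic field `K₀`** (`L = L⁺·K₀`, Galois over `ℚ` or
not — the whole «unitary group relative to `L/L⁺` coming from `K₀`» family): the induced CM type `Ind_{K₀}^{L} {τ ∘ j}`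
is `τ`-adapted with small reflex (`Aux.exists_isAdapted_and_hasSmallReflex_of_quadraticSubfield`,
[MilneCM2006] Prop. 1.18 (c) / [Shimura1998] §8.4 Ex. (1)).  §16 `quadraticSubfieldCase_of_F1` of the crux workfile.
[cite: Deligne1979ShimuraVarieties, 2.3.1] [cite: MilneCM2006, Ch. I §1 Prop. 1.18 (c)] [cite: Liu2021, App. C Rem. C.15] -/
theorem quadraticSubfieldCase_of_F1 (hF1 : Aux.canonicalModel_exists_printed) {K₀ : Type} [Field K₀] [NumberField K₀]
    [IsTotallyComplex K₀] (h2 : Module.finrank ℚ K₀ = 2) :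
    ∀ (L : Type) [Field L] [NumberField L] [IsCMField L] (j : K₀ →+* L) (H : Matrix (Fin 3) (Fin 3) L) (τ : L →+* ℂ)
      (T : GL (Fin 3) ℂ) (hT : formCongr (starRingEnd ℂ) T (H.map τ) = BallModel.J),
      (∀ τ' : L →+* ℂ, InfinitePlace.mk τ' ≠ InfinitePlace.mk τ → (H.map τ').PosDef) →
      (∀ v : Fin 3 → L, hermForm (cmConjRingHom L) H v v = 0 → v = 0) →
      ∀ K₀ : C5.OpenCompactSubgroup ↥(finAdelic (↥(maximalRealSubfield L)) L (IsCMField.complexConj L) 3 H),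
        (∀ g : finAdelic (↥(maximalRealSubfield L)) L (IsCMField.complexConj L) 3 H,
          ∀ γ ∈ arithmeticLevel (↥(maximalRealSubfield L)) L (IsCMField.complexConj L) 3 H
            (K₀.1.map (MulAut.conj g).toMonoidHom), IsOfFinOrder γ → γ = 1) →
        ∀ Sc : ComplexRecordSystem L H τ T hT K₀,
          ∃ (M : C5.SmallLevel K₀ ⥤ SchemeOver L) (e : (M ⋙ baseChangeHom τ) ≅ Sc.Mc),
            IsCanonicalDescentAt Sc M e :=
  fun L _ _ _ j H τ T hT hpos hanis K₀ htf Sc =>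
    smallReflexCase_of_F1 hF1 L H τ T hT hpos hanis K₀ htf Sc
      (Aux.exists_isAdapted_and_hasSmallReflex_of_quadraticSubfield h2 j τ)

end Summit.HodgeConjecture.CorCM.HypDel

end
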